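import Literature.NumberTheory.LFunctions.Zhang2022.KnifeEdgeLambdaBlock
import Literature.NumberTheory.LFunctions.Zhang2022.KnifeEdgeTwoBlockCriterion
import Literature.NumberTheory.LFunctions.Zhang2022.KnifeEdgeThreshold

/-!
# Zhang (2022) §18-margin repair rung, programme F-S3 §E (cell landau-siegel, barrier extension, seat p5):
# the `R⁺⁺` family of B-multi's sub-class M2 «Λ-type coefficient pieces» — `familyLambdaBlock K X`,
# `familyLambdaBlockAll`, the EXACT criterion of the Λ-block, and the §E wrap of registry row E-030

Y. Zhang, *Discrete mean estimates and the Landau–Siegel zero*, arXiv:2211.02515v1 [Zhang2022LandauSiegel] —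
an unrefereed manuscript under adjudication. **WHAT THIS IS NOT: not a claim about Theorems 1–2 of
arXiv:2211.02515, about Landau–Siegel zeros, about a repaired `Margin232`, or about Parity; nothing here asserts
any claim of the manuscript or any estimate. The programme SEARCHES and TYPES; no claim until a kernel theorem
says so.** Stub S-E-p5-3 of `barrier/ASSIGNMENTS.md` (ls-barrier-plan INBOX 2026-08-26T18:00:04Z + SHAPE NOTE
18:25:26Z), the §E WRAP of the B-multi typer's MODEL of registry row E-030 «E-multi-main(Lambda-type)» —
`KnifeEdgeLambdaBlock` (p459168: `KnifeEdge.LambdaPiece`/`.Admissible`, `lambdaPoly`, `lambdaDesign`,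
`lambdaBlockMainTerm K X u u' L c = 𝔅(u) + 2Re(κ_×(u,λ)·c) + |c|²·K_Λ(λ)`, the bare `Prop`s `EMultiLambda`,
`LambdaDiagNonneg K`, `LambdaBlockCS K X`, `EMultiLambdaCloses`, `LambdaBlockIndefinite`, the PROVED certificate
`lambdaBlockMainTerm_nonneg_of_cs` and tightness `eMultiLambdaCloses_of_indefinite`) — into the extension protocol of
`RepairRplus` (p455670: `Repair.DesignFamily`, `Repair.rplus_extend`), in the shape of `KnifeEdge.familyWallBand`
(p459421) / `Repair.familyJumpBlockAll` (RepairJumpBlock). Nothing of p459168 is re-typed; its decls are CITED.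

**C1 — the class (KILL word of record).** B-multi was KILLED (director-frontier, cell INBOX 2026-08-26T18:10:26Z;
certificate B-multi/KILL-draft.md = KILL-CERT v2.4 sha16 96c2304f42278a63; intake ls-barrier-plan STATUS 18:18:02Z:
«M2 familyLambdaBlock (p5 g2, wrap p459168)»). The sub-class text, VERBATIM (KILL-CERT §2): «(L-b) (O2) coefficient
classes on blocks with tops ≤ 1: Λ-type a(n) = χψ(n)·(Λ^{∗k}/log^k P)(n)·PPE(z_n), k ∈ {1,2} (Feng K = 2/3 shapes) =
M2», carried next to an in-class `χψ`-smooth side-1 piece (KILL-CERT §2 (L-a): PPE profiles, tops `≤ 1`; the M2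
members of record multi-lambda-001/002: `u = ϰ(ν₁,k₁)` of `θ₀`, Λ-profile `P₂(z) = z(1 − 125z/63)` resp.
`P₃(z) = z²(1 − 125z/63)` on `[0, 63/125]`, balanced amplitude `c`). Lean class = `Repair.LambdaDesign.InClass`:
`Repair.KinkedProfile u u'` ∧ `u 1 = 0` ∧ `L.Admissible` (p459168's binders verbatim). DECLARED DIFFERENCES: (i) WIDER —
any convolution order `k ≥ 1` (the word: `k ∈ {1,2}`), any bounded profile (the word: PPE(ℚ[i]); only the values on
`[0, ν]` are ever sampled by `lambdaPoly`, so a PPE profile is taken cut off to its block — `fengProfile1/2` below), any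
amplitude `c ∈ ℂ`; (ii) the in-class side is ONE kinked continuous `H¹` profile on `[0,1]` with `u(1) = 0` — this covers
every free-`ι` sum of Zhang's `ϰ`-pieces and every continuously glued PPE side-1 profile with tops `≤ 1` (kinked profiles
form a subspace, `Repair.KinkedProfile.add_smul`), but NOT a `χψ`-side with interior jumps (M1 ∪ M2 mixed) or a wall
value `u(1⁻) ≠ 0` (M3 ∪ M2 mixed), nor a member with TWO Λ-pieces of different orders read as three blocks: those are
MIXED members, the Gram family `familyGramBlock` of S-E-t1-1 over `KnifeEdgeGramPSD` (p460485) — not claimed here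
(one Λ-piece per design; multi-lambda-002 is covered piece by piece).

**C3 — currency and displayed slots (REF-E C3/C3(e)).** MODEL currency of E-030: the verdict is about the model
constant `lambdaBlockMainTerm K X u u' L c` in a parameter world `(K, X) = (K_Λ, κ_×)` (B-multi's «balanced reading»;
derivation in-house, NOT carried out — ls-theory INBOX 16:51:20Z Q1 is HEURISTIC factor counting; the two E-030-constant
rows of DESIGN-MAP-multi are INERT by price). That the (A)-world main term of a Λ-design IS such a block for some
`(K, X)` is registry E-030 itself — open, not claimed («validity: E-030 open»). Displayed slots, kind (c), never folded
into the class: `LambdaDiagNonneg K` (`K_Λ ≥ 0`, ls-theory Q1(i)) and `LambdaBlockCS K X` (`|κ_×|² ≤ 𝔅(u)·K_Λ`, the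
(B1) shape; KILL-CERT §4 rows `LambdaBlockPSD` / `GramPSD_k`, k = 2). Their negation on a member =
`LambdaBlockIndefinite K X` = B-multi's «knife edge #3» report shape = KILL-CERT's (c)-door (registry E-085) — by
`KnifeEdge.theorem1_of_eMultiLambda_indefinite` (p459168) an indefinite block that IS the main term would already give
Theorem 1, which is why the cell prices it first as a dictionary-consistency test. At the DISCRETE level the 2×2 Gram
block of the two value tables `(H_u, H_λ)` satisfies both slot shapes at every modulus with weights `≥ 0`
(`KnifeEdge.norm_sq_discPolar_le` p459102, `KnifeEdge.discGram_posSemidef` p460485) — a theorem about the discrete form,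
not about `(K, X)`.

**Contents.** Part 1: the model constant IS a two-block pencil (`lambdaBlockMainTerm_eq_twoBlockPencil`: bulk slot =
`K_Λ(λ)` on the amplitude `c`, coupling `κ_×`, constant block `𝔅(u)`), and a pencil with a NEGATIVE `|c|²`-coefficient
is negative somewhere (`twoBlockPencil_exists_neg_of_neg`). Part 2 — THE EXACT CRITERION (new; p459168 has the two
one-way halves): `lambdaNull_iff : LambdaNull K X ↔ LambdaDiagNonneg K ∧ LambdaBlockCS K X` (Sylvester `n = 2`,
`KnifeEdge.twoBlockPencil_nonneg_iff`, p458738), `lambdaDiagNonneg_of_cs` (the diagonal slot FOLLOWS from the CS slot,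
tested at `ϰ_{1,5/2}` with `𝔅 > 0`, `KnifeEdge.mainTermForm_kappaP_one_pos`), hence `lambdaNull_iff_cs` and
**`eMultiLambdaCloses_iff_indefinite : EMultiLambdaCloses K X ↔ LambdaBlockIndefinite K X`** — in the model world the
M2 class closes by positivity IFF the derived block is indefinite on a member: the (c)-door is the ONLY door, with no
sign hypothesis on `K_Λ` (a negative `K_Λ` already violates CS at `ϰ_{1,5/2}`). Part 3 — the families:
`LambdaDesign`/`.InClass`, `familyLambdaBlock K X` (Verdict `LambdaDiagNonneg K → LambdaBlockCS K X →
¬ (lambdaBlockMainTerm K X u u' L c < 0)`), `familyLambdaBlock_decided`, `rplus_lambda_decided`; the CLOSED term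
`familyLambdaBlockAll` (worlds quantified inside the Verdict, the shape of `familyWallBand`) with
`familyLambdaBlockAll_iff`, `familyLambdaBlockAll_decided`, `rplus_lambdaAll_decided` — the member p3's `bmultiWord3`
appends; unbundled `not_repairable_lambdaBlock`. Part 4 — C2: at amplitude `c = 0` a member is its in-class profile alone
and the verdict is `R̄`'s positivity `0 ≤ 𝔅(u)` UNCONDITIONALLY (`lambdaBlock_verdict_zero`, `lambdaBlockMainTerm_zero` +
`mainTermForm_nonneg_of_isH1`); C4: the two members of record as DATA — `lambdaPieceFeng1` (`k = 1`,
`P₂ = z(1 − 125z/63)` on `[0,63/125]`), `lambdaPieceFeng2` (`k = 2`, `P₃ = z²(1 − 125z/63)`), both admissible, glued to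
`u = ϰ(63/125, 3/2)` (`lambdaDesignFeng1/2`, in class for every amplitude). Part 5 — the slots are inhabited and
load-bearing: the CS-SATURATING world (`K ≡ 1`, `κ_×(u,λ) = √𝔅(u)` — ls-theory's «geometric-mean order») carries both
slots with EQUALITY and there the pencil TOUCHES zero at `c = −√𝔅(u)` (`saturatingWorld_slots`,
`lambdaBlockMainTerm_saturating_touch`: the verdict's inequality is sharp, null but not closing); a negative diagonal
closes in every cross world (`eMultiLambdaCloses_of_negDiag`); and for EVERY member with any admissible piece there is
a world with `K ≡ 1 > 0` in which it closes (`lambdaCross_slot_loadBearing`, via p459168's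
`eMultiLambdaCloses_of_indefinite`) — so the verdict cannot drop `LambdaBlockCS`. No numeric certificate is consumed
(structural; `mainTermForm_kappaP_one_pos` is p1's KnifeEdgeThreshold lemma over the certified enclosure p428360);
axioms standard. References: Zhang, arXiv:2211.02515v1, §2 (2.15)–(2.20), (2.23)–(2.25), Lemma 2.3; §7 Prop 7.1
(7.2) p.44 [cite: Zhang2022LandauSiegel, §2 Lemma 2.3, §7 Prop 7.1 (7.2)]; S. Feng, arXiv:1003.0059, (1.11) p.2
[cite: Feng2012CriticalLine, (1.11)]; R. Horn, C. Johnson, *Matrix Analysis* 2nd ed., Thm 7.2.5 [cite: HornJohnson2013,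
Thm 7.2.5]; cell files barrier/ASSIGNMENTS.md S-E-p5-3, B-multi/KILL-draft.md (KILL-CERT v2.4) §2/§4/§8,
ls-barrier-plan/COVERAGE.md row M2. «The programme SEARCHES and TYPES; no claim about Landau–Siegel zeros, Theorems 1–2
of arXiv:2211.02515 or a repaired Margin232 until a kernel theorem says so.»
-/

noncomputable section

open Complex Real Set

namespace Literature.NumberTheory.LFunctions.Zhang2022

namespace Repair

open KnifeEdge

variable {K : LambdaDiag} {X : LambdaCross} {u u' : ℝ → ℂ} {L : LambdaPiece}

/-! ### Part 1 — the Λ-block value is a two-block pencil in the amplitude -/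

/-- **The model constant of a Λ-design IS a two-block pencil in the amplitude `c`:** bulk slot `K_Λ(λ)` (the `|c|²`
coefficient), coupling `κ_×(u,λ)`, constant block `𝔅(u)` — `KnifeEdge.twoBlockPencil (K L) (X u u' L) (𝔅 u) c`.
[cite: Zhang2022LandauSiegel, §7 Prop 7.1 (7.2)] -/
theorem lambdaBlockMainTerm_eq_twoBlockPencil (K : LambdaDiag) (X : LambdaCross) (u u' : ℝ → ℂ) (L : LambdaPiece)
    (c : ℂ) : lambdaBlockMainTerm K X u u' L c = twoBlockPencil (K L) (X u u' L) (mainTermForm u u') c := by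
  unfold lambdaBlockMainTerm twoBlockPencil
  rw [mul_comm (X u u' L) c]
  ring

/-- A pencil `a|s|² + 2Re(s·c) + r` with NEGATIVE leading coefficient `a < 0` is negative somewhere (test `s = ±t`,
`t = √((|r|+1)/(−a))`: the two values add up to `2(a t² + r) = 2(r − |r| − 1) < 0`). [cite: HornJohnson2013, Thm 7.2.5] -/
theorem twoBlockPencil_exists_neg_of_neg {a : ℝ} (ha : a < 0) (c : ℂ) (r : ℝ) :
    ∃ s : ℂ, twoBlockPencil a c r s < 0 := by
  by_contra hcon
  push Not at hcon
  set t : ℝ := Real.sqrt ((|r| + 1) / (-a)) with ht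
  have hpos : 0 ≤ (|r| + 1) / (-a) := div_nonneg (by positivity) (by linarith)
  have ht2 : t ^ 2 = (|r| + 1) / (-a) := Real.sq_sqrt hpos
  have hane : a ≠ 0 := ha.ne
  have hat : a * t ^ 2 = -(|r| + 1) := by
    rw [ht2]
    field_simp
  have h1 := hcon (t : ℂ)
  have h2 := hcon (-(t : ℂ))
  unfold twoBlockPencil at h1 h2
  have n1 : ‖(t : ℂ)‖ ^ 2 = t ^ 2 := by rw [Complex.norm_real, Real.norm_eq_abs, sq_abs]
  have n2 : ‖-(t : ℂ)‖ ^ 2 = t ^ 2 := by rw [norm_neg, n1]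
  have r1 : ((t : ℂ) * c).re = t * c.re := by simp [Complex.mul_re]
  have r2 : (-(t : ℂ) * c).re = -(t * c.re) := by simp [Complex.mul_re]
  rw [n1, r1] at h1
  rw [n2, r2] at h2
  have hr : r ≤ |r| := le_abs_self r
  linarith

/-! ### Part 2 — the exact criterion of the Λ-block (Sylvester `n = 2`) -/

/-- **NULL of the model world `(K, X)`:** no member of the class (kinked in-class `u` with `u(1) = 0`, admissible
Λ-piece, any amplitude) has a negative model constant — the negation of p459168's `EMultiLambdaCloses K X`
(`eMultiLambdaCloses_iff_not_null`). Candidate shape, NOT asserted for any world. [cite: Zhang2022LandauSiegel, §7 Prop 7.1 (7.2)] -/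
def LambdaNull (K : LambdaDiag) (X : LambdaCross) : Prop :=
  ∀ (u u' : ℝ → ℂ) (L : LambdaPiece) (c : ℂ), KinkedProfile u u' → u 1 = 0 → L.Admissible →
    0 ≤ lambdaBlockMainTerm K X u u' L c

/-- Closing is the failure of the null. [cite: Zhang2022LandauSiegel, §7 Prop 7.1 (7.2)] -/
theorem eMultiLambdaCloses_iff_not_null : EMultiLambdaCloses K X ↔ ¬ LambdaNull K X := by
  unfold EMultiLambdaCloses LambdaNull
  push Not
  constructor
  · rintro ⟨u, u', L, c, hu, hu1, hL, h⟩
    exact ⟨u, u', L, c, hu, hu1, hL, h⟩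
  · rintro ⟨u, u', L, c, hu, hu1, hL, h⟩
    exact ⟨u, u', L, c, hu, hu1, hL, h⟩

/-- **A negative Λ-diagonal closes, in EVERY cross world:** if `K_Λ(λ) < 0` on some admissible piece, the member
`0 ⊕ c·λ` (zero in-class profile) has a negative constant for a suitable amplitude. [cite: Zhang2022LandauSiegel, §7 Prop 7.1 (7.2)] -/
theorem eMultiLambdaCloses_of_negDiag (h : ∃ L : LambdaPiece, L.Admissible ∧ K L < 0) :
    EMultiLambdaCloses K X := by
  obtain ⟨L, hL, hneg⟩ := h
  obtain ⟨s, hs⟩ := twoBlockPencil_exists_neg_of_neg hneg (X (fun _ => (0:ℂ)) (fun _ => (0:ℂ)) L)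
    (mainTermForm (fun _ => (0:ℂ)) (fun _ => (0:ℂ)))
  refine ⟨fun _ => 0, fun _ => 0, L, s, kinkedProfile_zero, rfl, hL, ?_⟩
  rw [lambdaBlockMainTerm_eq_twoBlockPencil]
  exact hs

/-- **THE EXACT CRITERION of the Λ-block (model world):** no member closes iff the Λ-diagonal is `≥ 0` on admissible
pieces AND the coupling is Cauchy–Schwarz-subordinate — an iff with `≤`, covering the degenerate amplitudes
(`K_Λ(λ) = 0` forces `κ_×(·,λ) = 0`) and the in-class kernel modes `𝔅(u) = 0`. The (←) half is p459168's
`lambdaBlockMainTerm_nonneg_of_cs`; (→) is Sylvester `n = 2` (`KnifeEdge.twoBlockPencil_nonneg_iff`, p458738) after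
`twoBlockPencil_exists_neg_of_neg` has produced the sign of `K_Λ`. [cite: HornJohnson2013, Thm 7.2.5] -/
theorem lambdaNull_iff : LambdaNull K X ↔ LambdaDiagNonneg K ∧ LambdaBlockCS K X := by
  constructor
  · intro h
    have hK : LambdaDiagNonneg K := by
      intro L hL
      by_contra hneg
      push Not at hneg
      exact (eMultiLambdaCloses_iff_not_null.1 (eMultiLambdaCloses_of_negDiag (X := X) ⟨L, hL, hneg⟩)) h
    refine ⟨hK, fun u u' L hu hu1 hL => ?_⟩
    have hall : ∀ s : ℂ, 0 ≤ twoBlockPencil (K L) (X u u' L) (mainTermForm u u') s := fun s => by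
      rw [← lambdaBlockMainTerm_eq_twoBlockPencil]
      exact h u u' L s hu hu1 hL
    have crit := (twoBlockPencil_nonneg_iff (hK L hL)).1 hall
    rw [mul_comm]
    exact crit.2
  · rintro ⟨hK, hX⟩ u u' L c hu hu1 hL
    exact lambdaBlockMainTerm_nonneg_of_cs hK hX hu hu1 hL c

/-- **The diagonal slot FOLLOWS from the CS slot:** testing `|κ_×(u₀,λ)|² ≤ 𝔅(u₀)·K_Λ(λ)` on the in-class piece
`u₀ = ϰ_{1,5/2}` (`𝔅(u₀) > 0`, `KnifeEdge.mainTermForm_kappaP_one_pos`) forces `K_Λ(λ) ≥ 0` — so ONE displayed slot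
suffices for the M2 verdict. [cite: Zhang2022LandauSiegel, (2.23)–(2.25) p.9; §7 Prop 7.1 (7.2)] -/
theorem lambdaDiagNonneg_of_cs (hX : LambdaBlockCS K X) : LambdaDiagNonneg K := by
  intro L hL
  have h := hX (kappaP 1 (5/2)) (kappaP' 1 (5/2)) L (kinkedProfile_kappaP one_pos le_rfl)
    (kappaP_one one_pos le_rfl) hL
  have hpos := mainTermForm_kappaP_one_pos
  by_contra hneg
  push Not at hneg
  have hprod : mainTermForm (kappaP 1 (5/2)) (kappaP' 1 (5/2)) * K L < 0 := mul_neg_of_pos_of_neg hpos hneg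
  have hsq := sq_nonneg ‖X (kappaP 1 (5/2)) (kappaP' 1 (5/2)) L‖
  linarith

/-- … hence the criterion with the single slot: **no member closes iff the coupling is CS-subordinate.**
[cite: HornJohnson2013, Thm 7.2.5] -/
theorem lambdaNull_iff_cs : LambdaNull K X ↔ LambdaBlockCS K X :=
  ⟨fun h => (lambdaNull_iff.1 h).2, fun h => lambdaNull_iff.2 ⟨lambdaDiagNonneg_of_cs h, h⟩⟩

/-- **THE ONLY DOOR: the M2 model closes iff the derived block is INDEFINITE on some member** — B-multi's
«knife edge #3» report shape `LambdaBlockIndefinite K X` (KILL-CERT (c)-door, registry E-085) is exactly the closing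
criterion, with NO sign hypothesis on `K_Λ` (p459168's `eMultiLambdaCloses_of_indefinite` needed `K_Λ > 0`).
[cite: Zhang2022LandauSiegel, §7 Prop 7.1 (7.2)] -/
theorem eMultiLambdaCloses_iff_indefinite : EMultiLambdaCloses K X ↔ LambdaBlockIndefinite K X := by
  rw [eMultiLambdaCloses_iff_not_null, lambdaNull_iff_cs]
  constructor
  · intro h
    unfold LambdaBlockCS at h
    push Not at h
    obtain ⟨u, u', L, hu, hu1, hL, hlt⟩ := h
    exact ⟨u, u', L, hu, hu1, hL, hlt⟩
  · exact lambdaBlockIndefinite_not_cs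

/-- On an in-class KERNEL MODE (`𝔅(u) = 0`, e.g. `g⋆`: `Repair.mainTermForm_gStar`) the CS slot forces the Λ-coupling
to VANISH. [cite: HornJohnson2013, Thm 7.2.5] -/
theorem lambdaCross_eq_zero_of_kernelMode (hX : LambdaBlockCS K X) (hu : KinkedProfile u u') (hu1 : u 1 = 0)
    (hL : L.Admissible) (h0 : mainTermForm u u' = 0) : X u u' L = 0 := by
  have h := hX u u' L hu hu1 hL
  rw [h0, zero_mul] at h
  exact norm_eq_zero.1 (pow_eq_zero_iff two_ne_zero |>.1 (le_antisymm h (sq_nonneg _)))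

/-! ### Part 3 — the families for the extension protocol of `RepairRplus` -/

/-- **A design of sub-class M2:** a side-1 in-class profile `u` (marked right derivative `u'`), ONE Λ-type piece `L`
(order `k`, length `ν`, profile `p`) and the Λ-piece's balanced amplitude `c` — the realised value table is p459168's
`lambdaDesign χ u L c Λ_s`. [cite: Zhang2022LandauSiegel, §2 (2.23)–(2.25), §7 (7.2)] [cite: Feng2012CriticalLine, (1.11)] -/
structure LambdaDesign where
  /-- the in-class `χψ`-smooth side-1 profile -/
  u : ℝ → ℂ
  /-- its marked right derivative -/
  u' : ℝ → ℂ
  /-- the Λ-type piece (order, length, profile) -/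
  L : LambdaPiece
  /-- the balanced amplitude of the Λ-piece -/
  c : ℂ

/-- **Membership in M2** (p459168's binders verbatim; NO analytic hypothesis inside): `u` a kinked `H¹` profile on
`[0,1]` with `u(1) = 0`, `L` admissible (`k ≥ 1`, `0 < ν ≤ 1`, bounded profile). [cite: Zhang2022LandauSiegel, §7 (7.2)] -/
structure LambdaDesign.InClass (d : LambdaDesign) : Prop where
  kinked : KinkedProfile d.u d.u'
  wall : d.u 1 = 0
  adm : d.L.Admissible

/-- **The family «M2 Λ-type block in the model world `(K, X)`»**: verdict = with the two DISPLAYED slots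
`LambdaDiagNonneg K` (E-030, `K_Λ ≥ 0`) and `LambdaBlockCS K X` (E-030 in (B1) form) the member's model constant is
not negative. [cite: Zhang2022LandauSiegel, §7 Prop 7.1 (7.2)] -/
def familyLambdaBlock (K : LambdaDiag) (X : LambdaCross) : DesignFamily where
  Design := LambdaDesign
  InClass d := d.InClass
  Verdict d := LambdaDiagNonneg K → LambdaBlockCS K X → ¬ (lambdaBlockMainTerm K X d.u d.u' d.L d.c < 0)

/-- **The M2 family is decided in every model world** (by p459168's `lambdaBlockMainTerm_nonneg_of_cs`).
[cite: Zhang2022LandauSiegel, §7 Prop 7.1 (7.2)] -/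
theorem familyLambdaBlock_decided (K : LambdaDiag) (X : LambdaCross) : (familyLambdaBlock K X).Decided :=
  fun d hd hK hX => not_lt.2 (lambdaBlockMainTerm_nonneg_of_cs hK hX hd.kinked hd.wall hd.adm d.c)

/-- In fact the CS slot alone gives the verdict (`lambdaDiagNonneg_of_cs`). [cite: Zhang2022LandauSiegel, §7 Prop 7.1 (7.2)] -/
theorem familyLambdaBlock_verdict_of_cs (hX : LambdaBlockCS K X) {d : LambdaDesign} (hd : d.InClass) :
    ¬ (lambdaBlockMainTerm K X d.u d.u' d.L d.c < 0) :=
  familyLambdaBlock_decided K X d hd (lambdaDiagNonneg_of_cs hX) hX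

/-- **`R⁺ ++ [M2 in the world (K, X)]` is decided** (`Repair.rplus_extend`). [cite: Zhang2022LandauSiegel, §2 (2.32)–(2.33); §7 Prop 7.1 (7.2)] -/
theorem rplus_lambda_decided (K : LambdaDiag) (X : LambdaCross) : ClassDecided (Rplus ++ [familyLambdaBlock K X]) :=
  rplus_extend (familyLambdaBlock_decided K X)

/-- **The CLOSED family «M2, all model worlds»** (the member of the intake list `bmultiWord`; worlds quantified inside
the verdict, the shape of `KnifeEdge.familyWallBand`): verdict = in EVERY world `(K, X)` carrying the two displayed
slots, the member's model constant is not negative. [cite: Zhang2022LandauSiegel, §7 Prop 7.1 (7.2)] -/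
def familyLambdaBlockAll : DesignFamily where
  Design := LambdaDesign
  InClass d := d.InClass
  Verdict d := ∀ (K : LambdaDiag) (X : LambdaCross), LambdaDiagNonneg K → LambdaBlockCS K X →
    ¬ (lambdaBlockMainTerm K X d.u d.u' d.L d.c < 0)

/-- Membership / verdict of the closed family versus the world-parametric one: same class; the closed verdict is the
conjunction over all worlds. [cite: Zhang2022LandauSiegel, §7 Prop 7.1 (7.2)] -/
theorem familyLambdaBlockAll_iff (d : LambdaDesign) :
    (familyLambdaBlockAll.InClass d ↔ ∀ (K : LambdaDiag) (X : LambdaCross), (familyLambdaBlock K X).InClass d) ∧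
      (familyLambdaBlockAll.Verdict d ↔ ∀ (K : LambdaDiag) (X : LambdaCross), (familyLambdaBlock K X).Verdict d) :=
  ⟨⟨fun h _ _ => h, fun h => h (fun _ => 0) (fun _ _ _ => 0)⟩, Iff.rfl⟩

/-- The closed family is decided iff every world-parametric family is. [cite: Zhang2022LandauSiegel, §7 Prop 7.1 (7.2)] -/
theorem familyLambdaBlockAll_decided_iff :
    familyLambdaBlockAll.Decided ↔ ∀ (K : LambdaDiag) (X : LambdaCross), (familyLambdaBlock K X).Decided :=
  ⟨fun h K X d hd => h d hd K X, fun h d hd K X => h K X d hd⟩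

/-- **The closed M2 family is decided.** [cite: Zhang2022LandauSiegel, §7 Prop 7.1 (7.2)] -/
theorem familyLambdaBlockAll_decided : familyLambdaBlockAll.Decided :=
  familyLambdaBlockAll_decided_iff.2 familyLambdaBlock_decided

/-- **`R⁺ ++ [M2, all worlds]` is decided** (the form the running assembly / `bmultiWord3` appends).
[cite: Zhang2022LandauSiegel, §2 (2.32)–(2.33); §7 Prop 7.1 (7.2)] -/
theorem rplus_lambdaAll_decided : ClassDecided (Rplus ++ [familyLambdaBlockAll]) :=
  rplus_extend familyLambdaBlockAll_decided

/-- The verdict unbundled (every hypothesis a binder). [cite: Zhang2022LandauSiegel, §7 Prop 7.1 (7.2)] -/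
theorem not_repairable_lambdaBlock (hK : LambdaDiagNonneg K) (hX : LambdaBlockCS K X) (hu : KinkedProfile u u')
    (hu1 : u 1 = 0) (hL : L.Admissible) (c : ℂ) : ¬ (lambdaBlockMainTerm K X u u' L c < 0) :=
  familyLambdaBlockAll_decided ⟨u, u', L, c⟩ ⟨hu, hu1, hL⟩ K X hK hX

/-! ### Part 4 — C2 (amplitude `0` = the `R̄` profile alone) and C4 (the members of record as data) -/

/-- **C2 — at amplitude `c = 0` the member is its in-class profile alone and the verdict is `R̄`'s positivity
`0 ≤ 𝔅(u)`, UNCONDITIONALLY** (no slot: `lambdaBlockMainTerm_zero` + `mainTermForm_nonneg_of_isH1`; the `R̄`-verdict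
`Repair.not_repairable_in_Rplus_hOne` is the polar-CS form of the same positivity). [cite: Zhang2022LandauSiegel, §2 (2.18); §7 Prop 7.1 (7.2)] -/
theorem lambdaBlock_verdict_zero (K : LambdaDiag) (X : LambdaCross) (hu : KinkedProfile u u') (L : LambdaPiece) :
    ¬ (lambdaBlockMainTerm K X u u' L 0 < 0) := by
  rw [lambdaBlockMainTerm_zero]
  exact not_lt.2 (mainTermForm_nonneg_of_isH1 hu.isH1)

/-- **multi-lambda-001's Λ-profile as data:** Feng's `P₂(z) = z(1 − z/ν₁) = z(1 − 125z/63)` on `[0, 63/125]`, cut off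
to its block (only block values are sampled by `lambdaPoly`). [cite: Feng2012CriticalLine, (1.11)] -/
def fengProfile1 (z : ℝ) : ℂ :=
  if 0 ≤ z ∧ z ≤ 63 / 125 then (((z * (1 - 125 / 63 * z)) : ℝ) : ℂ) else 0

/-- **multi-lambda-002's Λ∗Λ-profile as data:** `P₃(z) = z²(1 − 125z/63)` on `[0, 63/125]`, cut off to its block.
[cite: Feng2012CriticalLine, (1.11)] -/
def fengProfile2 (z : ℝ) : ℂ :=
  if 0 ≤ z ∧ z ≤ 63 / 125 then (((z ^ 2 * (1 - 125 / 63 * z)) : ℝ) : ℂ) else 0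

/-- The profiles are bounded by `1`. [cite: Feng2012CriticalLine, (1.11)] -/
theorem norm_fengProfile1_le (z : ℝ) : ‖fengProfile1 z‖ ≤ 1 := by
  unfold fengProfile1
  split_ifs with h
  · obtain ⟨h0, h1⟩ := h
    rw [Complex.norm_real, Real.norm_eq_abs, abs_le]
    constructor <;> nlinarith
  · simp

/-- The profiles are bounded by `1`. [cite: Feng2012CriticalLine, (1.11)] -/
theorem norm_fengProfile2_le (z : ℝ) : ‖fengProfile2 z‖ ≤ 1 := by
  unfold fengProfile2
  split_ifs with h
  · obtain ⟨h0, h1⟩ := h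
    have hz2 : z ^ 2 ≤ 1 := by nlinarith
    have hz0 : 0 ≤ z ^ 2 := sq_nonneg z
    rw [Complex.norm_real, Real.norm_eq_abs, abs_le]
    constructor <;> nlinarith
  · simp

/-- **The Λ-piece of multi-lambda-001** (`k = 1`: coefficients `χψ(n)·Λ(n)/log P·P₂(z_n)`, length `ν₁ = 63/125 = 0.504`).
[cite: Zhang2022LandauSiegel, §2 (2.21)] [cite: Feng2012CriticalLine, (1.11)] -/
def lambdaPieceFeng1 : LambdaPiece := ⟨1, 63 / 125, fengProfile1⟩

/-- **The Λ∗Λ-piece of multi-lambda-002** (`k = 2`: coefficients `χψ(n)·(Λ∗Λ)(n)/log²P·P₃(z_n)`, length `63/125`).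
[cite: Zhang2022LandauSiegel, §2 (2.21)] [cite: Feng2012CriticalLine, (1.11)] -/
def lambdaPieceFeng2 : LambdaPiece := ⟨2, 63 / 125, fengProfile2⟩

/-- `lambdaPieceFeng1` is admissible. [cite: Zhang2022LandauSiegel, §7 (7.2)] -/
theorem admissible_lambdaPieceFeng1 : lambdaPieceFeng1.Admissible where
  order := le_rfl
  top_pos := by norm_num [lambdaPieceFeng1]
  top_le := by norm_num [lambdaPieceFeng1]
  bdd := ⟨1, norm_fengProfile1_le⟩

/-- `lambdaPieceFeng2` is admissible. [cite: Zhang2022LandauSiegel, §7 (7.2)] -/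
theorem admissible_lambdaPieceFeng2 : lambdaPieceFeng2.Admissible where
  order := by norm_num [lambdaPieceFeng2]
  top_pos := by norm_num [lambdaPieceFeng2]
  top_le := by norm_num [lambdaPieceFeng2]
  bdd := ⟨1, norm_fengProfile2_le⟩

/-- **multi-lambda-001 at amplitude `c`:** `ϰ(63/125, 3/2) ⊕ c·(Λ/log P)P₂`. [cite: Zhang2022LandauSiegel, §2 (2.21), (2.23)] -/
def lambdaDesignFeng1 (c : ℂ) : LambdaDesign := ⟨kappaP (63 / 125) (3 / 2), kappaP' (63 / 125) (3 / 2), lambdaPieceFeng1, c⟩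

/-- **multi-lambda-002's `k = 2` block at amplitude `c`:** `ϰ(63/125, 3/2) ⊕ c·(Λ∗Λ/log²P)P₃`.
[cite: Zhang2022LandauSiegel, §2 (2.21), (2.23)] -/
def lambdaDesignFeng2 (c : ℂ) : LambdaDesign := ⟨kappaP (63 / 125) (3 / 2), kappaP' (63 / 125) (3 / 2), lambdaPieceFeng2, c⟩

/-- **C4 — the members of record are in the class** (every amplitude): `ϰ_{ν,k}` is a kinked profile vanishing at `1`
for `0 < ν ≤ 1` (`Repair.kinkedProfile_kappaP`, `Repair.kappaP_one`). [cite: Zhang2022LandauSiegel, §2 (2.23)–(2.25); §7 (7.2)] -/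
theorem inClass_lambdaDesignFeng (c : ℂ) : (lambdaDesignFeng1 c).InClass ∧ (lambdaDesignFeng2 c).InClass :=
  ⟨⟨kinkedProfile_kappaP (by norm_num) (by norm_num), kappaP_one (by norm_num) (by norm_num), admissible_lambdaPieceFeng1⟩,
    ⟨kinkedProfile_kappaP (by norm_num) (by norm_num), kappaP_one (by norm_num) (by norm_num), admissible_lambdaPieceFeng2⟩⟩

/-- … hence members of both families (closed and world-parametric), with their verdicts.
[cite: Zhang2022LandauSiegel, §7 Prop 7.1 (7.2)] -/
theorem verdict_lambdaDesignFeng (c : ℂ) :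
    familyLambdaBlockAll.Verdict (lambdaDesignFeng1 c) ∧ familyLambdaBlockAll.Verdict (lambdaDesignFeng2 c) :=
  ⟨familyLambdaBlockAll_decided _ (inClass_lambdaDesignFeng c).1,
    familyLambdaBlockAll_decided _ (inClass_lambdaDesignFeng c).2⟩

/-! ### Part 5 — the slots are inhabited (with equality) and load-bearing -/

/-- **The CS-SATURATING world** (ls-theory Q1(ii): «κ_× of geometric-mean order»): `K_Λ ≡ 1`, `κ_×(u,λ) = √𝔅(u)`.
Pure data, asserted to be nothing. [cite: Zhang2022LandauSiegel, §7 Prop 7.1 (7.2)] -/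
def saturatingDiag : LambdaDiag := fun _ => 1

/-- The cross functional of the CS-saturating world, `κ_×(u,λ) = √𝔅(u)`. [cite: Zhang2022LandauSiegel, §7 Prop 7.1 (7.2)] -/
def saturatingCross : LambdaCross := fun u u' _ => ((Real.sqrt (mainTermForm u u') : ℝ) : ℂ)

/-- **The slots are inhabited, with EQUALITY in the CS slot** (`|κ_×|² = 𝔅(u)·K_Λ` on every member): no verdict
quantifying over slot-carrying worlds is vacuous, and the CS slot cannot be sharpened to a strict inequality.
[cite: Zhang2022LandauSiegel, §7 Prop 7.1 (7.2)] -/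
theorem saturatingWorld_slots :
    LambdaDiagNonneg saturatingDiag ∧ LambdaBlockCS saturatingDiag saturatingCross ∧
      ∀ (u u' : ℝ → ℂ) (L : LambdaPiece), KinkedProfile u u' →
        ‖saturatingCross u u' L‖ ^ 2 = mainTermForm u u' * saturatingDiag L := by
  have key : ∀ (u u' : ℝ → ℂ) (L : LambdaPiece), KinkedProfile u u' →
      ‖saturatingCross u u' L‖ ^ 2 = mainTermForm u u' * saturatingDiag L := fun u u' L hu => by
    unfold saturatingCross saturatingDiag
    rw [Complex.norm_real, Real.norm_eq_abs, sq_abs, Real.sq_sqrt (mainTermForm_nonneg_of_isH1 hu.isH1), mul_one]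
  exact ⟨fun _ _ => zero_le_one, fun u u' L hu _ _ => (key u u' L hu).le, key⟩

/-- **In the saturating world the pencil TOUCHES zero:** at the amplitude `c = −√𝔅(u)` the model constant of
`u ⊕ c·λ` is exactly `0` — null but not closing; the verdict `¬ (… < 0)` is sharp. [cite: Zhang2022LandauSiegel, §7 Prop 7.1 (7.2)] -/
theorem lambdaBlockMainTerm_saturating_touch (hu : KinkedProfile u u') (L : LambdaPiece) :
    lambdaBlockMainTerm saturatingDiag saturatingCross u u' L (-((Real.sqrt (mainTermForm u u') : ℝ) : ℂ)) = 0 := by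
  have hB : 0 ≤ mainTermForm u u' := mainTermForm_nonneg_of_isH1 hu.isH1
  set r : ℝ := Real.sqrt (mainTermForm u u') with hr
  have hr2 : r ^ 2 = mainTermForm u u' := Real.sq_sqrt hB
  unfold lambdaBlockMainTerm saturatingDiag saturatingCross
  rw [← hr]
  have h1 : ((r : ℂ) * -(r : ℂ)).re = -(r ^ 2) := by
    rw [mul_neg, Complex.neg_re, ← Complex.ofReal_mul, Complex.ofReal_re]; ring
  have h2 : ‖-(r : ℂ)‖ ^ 2 = r ^ 2 := by rw [norm_neg, Complex.norm_real, Real.norm_eq_abs, sq_abs]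
  rw [h1, h2, ← hr2]
  ring

/-- **The CS slot is load-bearing on EVERY member:** for any in-class `u` and admissible `λ` there is a world with
`K_Λ ≡ 1 > 0` (diagonal slot satisfied) in which `u ⊕ c·λ` closes — coupling `κ_× ≡ 𝔅(u) + 1`, indefinite since
`𝔅(u)·1 < (𝔅(u)+1)²`, closing by p459168's `eMultiLambdaCloses_of_indefinite`. So the verdict cannot drop `LambdaBlockCS`.
[cite: Zhang2022LandauSiegel, §7 Prop 7.1 (7.2)] -/
theorem lambdaCross_slot_loadBearing (hu : KinkedProfile u u') (hu1 : u 1 = 0) (hL : L.Admissible) :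
    ∃ (K : LambdaDiag) (X : LambdaCross), LambdaDiagNonneg K ∧ (∀ L' : LambdaPiece, L'.Admissible → 0 < K L') ∧
      EMultiLambdaCloses K X ∧ ¬ LambdaBlockCS K X := by
  set a : ℝ := mainTermForm u u' with ha
  have ha0 : 0 ≤ a := mainTermForm_nonneg_of_isH1 hu.isH1
  have hind : LambdaBlockIndefinite (fun _ => 1) (fun _ _ _ => ((a + 1 : ℝ) : ℂ)) := by
    refine ⟨u, u', L, hu, hu1, hL, ?_⟩
    change mainTermForm u u' * 1 < ‖((a + 1 : ℝ) : ℂ)‖ ^ 2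
    rw [← ha, Complex.norm_real, Real.norm_eq_abs, sq_abs]
    nlinarith
  exact ⟨fun _ => 1, fun _ _ _ => ((a + 1 : ℝ) : ℂ), fun _ _ => zero_le_one, fun _ _ => one_pos,
    eMultiLambdaCloses_of_indefinite (fun _ _ => one_pos) hind, lambdaBlockIndefinite_not_cs hind⟩

/-- **Instance on the member of record:** multi-lambda-001 closes in such a world (so the slot is load-bearing on
B-multi's own design, not only in the abstract). [cite: Zhang2022LandauSiegel, §7 Prop 7.1 (7.2)] -/
theorem lambdaCross_slot_loadBearing_feng1 :
    ∃ (K : LambdaDiag) (X : LambdaCross), LambdaDiagNonneg K ∧ (∀ L' : LambdaPiece, L'.Admissible → 0 < K L') ∧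
      EMultiLambdaCloses K X ∧ ¬ LambdaBlockCS K X :=
  lambdaCross_slot_loadBearing (L := lambdaPieceFeng1) (kinkedProfile_kappaP (ν := 63 / 125) (k := 3 / 2)
    (by norm_num) (by norm_num)) (kappaP_one (by norm_num) (by norm_num)) admissible_lambdaPieceFeng1

/-! ### Part 6 — addendum (REF-E pre-brief §0b-v5, cell INBOX 2026-08-26T19:03:41Z): the word's premise, the
design files of record, and the free-`ι` members by term

**Premise of the word (KILL-CERT v2.4 §1, verbatim head):** «KILL(B-multi) inside K_multi GIVEN B-AH (E-014)». The
family theorems of this file do NOT use B-AH: they are statements about the MODEL pencil `lambdaBlockMainTerm K X` in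
any world `(K, X)` carrying the displayed slots. B-AH (registry E-014) is the cell's premise for READING the slots
`LambdaDiagNonneg ∧ LambdaBlockCS` as properties of the (A)-world main term (the true discrete form is a sum of `|·|²`
under Lemma 2.3; at the discrete level the 2×2 Gram block satisfies both slot shapes by theorem —
`KnifeEdge.norm_sq_discPolar_le`, `KnifeEdge.discGram_posSemidef`); the negation of the slots on a member,
`LambdaBlockIndefinite K X`, is KILL-CERT's (c)-door = registry row E-085 (open, used in no word), and by
`eMultiLambdaCloses_iff_indefinite` it is EXACTLY the closing condition of the model. Status of E-030 (honest): derivation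
— step 1 (the parametric block, p459168) landed; step 2 (closed forms of `K_Λ`, `κ_×`; ls-theory Q1(iii) recipe) OPEN;
the two E-030 rows of DESIGN-MAP-multi are INERT by price. **Design files of record (C4 data, no number enters a
statement):** B-multi/designs/BATCH-1.json sha16 e90899402ce766c5; multi-lambda-001 input_sha16 432ee00e051d0347
(design sha16 75ad455651220bc4) = `lambdaDesignFeng1`; multi-lambda-002 input_sha16 2737206dee7364dd (design sha16
80f9c04d43d625bc), whose `k = 2` block is `lambdaDesignFeng2` (its `k = 1` block is `lambdaDesignFeng1`'s piece; the
member read as THREE blocks `u ⊕ λ₁ ⊕ λ₂` is a MIXED member — `familyGramBlock`, not here). **Free `ι` (KILL-CERT §2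
common box «any ι ∈ ℂ^m», guard G2 of the intake) by term:** a free-`ι` combination of two `ϰ`-pieces of lengths
`≤ 1` is ONE kinked in-class profile vanishing at the wall (`Repair.KinkedProfile.add_smul`, `Repair.kappaP_one`), so
`(ϰ(ν₁,k₁) + ι·ϰ(ν₂,k₂)) ⊕ c·λ` is a member for every `ι`, every admissible `λ`, every amplitude (`inClass_freeIota`),
with its verdict (`verdict_freeIota`). -/

/-- **The free-`ι` side-1 design** `(ϰ(ν₁,k₁) + ι·ϰ(ν₂,k₂)) ⊕ c·λ` as a `LambdaDesign`.
[cite: Zhang2022LandauSiegel, §2 (2.23)–(2.27); §7 (7.2)] -/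
def lambdaDesignIota (ν₁ k₁ ν₂ k₂ : ℝ) (ι : ℂ) (L : LambdaPiece) (c : ℂ) : LambdaDesign :=
  ⟨fun y => kappaP ν₁ k₁ y + ι * kappaP ν₂ k₂ y, fun y => kappaP' ν₁ k₁ y + ι * kappaP' ν₂ k₂ y, L, c⟩

/-- **Free-`ι` members are in the class** for all lengths `0 < ν₁, ν₂ ≤ 1`, all shifts, every `ι`, every admissible
Λ-piece and every amplitude (kinked profiles form a subspace; both `ϰ`-pieces vanish at `1`).
[cite: Zhang2022LandauSiegel, §2 (2.23)–(2.27); §7 (7.2)] -/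
theorem inClass_freeIota {ν₁ k₁ ν₂ k₂ : ℝ} (h₁ : 0 < ν₁) (h₁' : ν₁ ≤ 1) (h₂ : 0 < ν₂) (h₂' : ν₂ ≤ 1) (ι : ℂ)
    {L : LambdaPiece} (hL : L.Admissible) (c : ℂ) : (lambdaDesignIota ν₁ k₁ ν₂ k₂ ι L c).InClass where
  kinked := (kinkedProfile_kappaP h₁ h₁').add_smul (kinkedProfile_kappaP h₂ h₂') ι
  wall := by
    change kappaP ν₁ k₁ 1 + ι * kappaP ν₂ k₂ 1 = 0
    rw [kappaP_one h₁ h₁', kappaP_one h₂ h₂']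
    simp
  adm := hL

/-- … with the family verdict in every slot-carrying world. [cite: Zhang2022LandauSiegel, §7 Prop 7.1 (7.2)] -/
theorem verdict_freeIota {ν₁ k₁ ν₂ k₂ : ℝ} (h₁ : 0 < ν₁) (h₁' : ν₁ ≤ 1) (h₂ : 0 < ν₂) (h₂' : ν₂ ≤ 1) (ι : ℂ)
    {L : LambdaPiece} (hL : L.Admissible) (c : ℂ) :
    familyLambdaBlockAll.Verdict (lambdaDesignIota ν₁ k₁ ν₂ k₂ ι L c) :=
  familyLambdaBlockAll_decided _ (inClass_freeIota h₁ h₁' h₂ h₂' ι hL c)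

/-- The printed side-1 pair of `θ₀` with free `ι₂` and the multi-lambda-001 piece: `(ϰ(63/125, 3/2) + ι₂·ϰ(1/2, 5/2)) ⊕ c·λ`
is a member (lengths `ν₁ = 0.504`, `ν₂ = 0.5`, shifts `k₁ = 3/2`, `k₂ = 5/2` of (2.21)–(2.24)).
[cite: Zhang2022LandauSiegel, §2 (2.21)–(2.24)] -/
theorem inClass_freeIota_theta0 (ι₂ c : ℂ) :
    (lambdaDesignIota (63 / 125) (3 / 2) (1 / 2) (5 / 2) ι₂ lambdaPieceFeng1 c).InClass :=
  inClass_freeIota (by norm_num) (by norm_num) (by norm_num) (by norm_num) ι₂ admissible_lambdaPieceFeng1 c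

end Repair

end Literature.NumberTheory.LFunctions.Zhang2022
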